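import Mathlib
import HarnessLib
import Summits.HubbardSuperconductivity.HubbardSuperconductivity.Theorems.KLProgrammeKLRegimeSplitPhRotationAngularExtension
import Summits.HubbardSuperconductivity.HubbardSuperconductivity.Theorems.KLProgrammeFermiSurfaceSharpEnvelope
import Summits.HubbardSuperconductivity.HubbardSuperconductivity.Theorems.KLProgrammeH10TwoPointLimitPerturbedFermiRadius

/-!
# Route `KLProgramme` — ENGINE (stmt-HubbardSuperconductivity-20437 `KLRegimeEngineV17F2`), row (c) binder #8 (★ v19 `hexLadMV`), value rows `RP/RQ`, brick O6i-d (part 4):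
# THE TUBE-RADIUS HYPOTHESIS OF `klpw_angularWeight_exists` DISCHARGED FROM THE C4a CHART DATA — `B.umin ≤ u_K(μ+ρ,ϑ) ≤ umklappRadius(μ + r + A) < π` — and the
# planar extension of an angular profile with NO residual geometric hypothesis
# (cell gate-hubbard-kl, seat hubbard-kl-k3c2-p2 g32, technique «thermal-bar induction n ≤ nScales β + 1 with EngineBoundsAtV4S sums»)

* `klpw_tubeRadius_bounds` — for `p.1 ∈ (−r, r)`: `B.umin ≤ u_K(μ+p.1, p.2) ≤ umklappRadius (μ + r + A)` (`umin_le_perturbedFermiRadius`, the free sandwich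
  `bandFermiRadius_le_perturbedFermiRadius_le`, level monotonicity `bandFermiRadius_le_of_level_le`, Karamata envelope `klfs_bandFermiRadius_le_umklappRadius`);
* **`klpw_angularWeight_exists_frame`** — `klpw_angularWeight_exists` with `u₀ = B.umin`, `R₁ = umklappRadius(μ + r + A)`, `R₂ = (R₁ + π)/2`: for every `2π`-periodic,
  `L_V`-Lipschitz, bounded angular profile `V` there is an admissible planar weight (continuous, doubly periodic, Lipschitz with an explicit constant, bounded, radially constant
  on the chart tube) — the consumer of O6i-b/c (`klpw_lattice_rotation_weighted_le`, `klpw_phValue_row_weighted_le`) supplies ONLY the profile.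
Pure composition; no definitions; nothing asserts (c), K3 or superconductivity.  [folklore]
-/

noncomputable section

namespace Summit.HubbardSuperconductivity.HubbardSuperconductivity.Theorems.KLRegimeSplit

set_option linter.dupNamespace false -- summit = problem name (single-conjunct summit), D-0017

open Real Set Literature.MathematicalPhysics.QuantumLattice Literature.Probability.LatticeModels
open Literature.MathematicalPhysics.QuantumLattice.BandSectorCounting
open Summit.HubbardSuperconductivity.HubbardSuperconductivity.Theorems.TwoPointAssembly
open Summit.HubbardSuperconductivity.HubbardSuperconductivity.Theorems.EngineV8
open Summit.HubbardSuperconductivity.HubbardSuperconductivity.Theorems.DispersionFlow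
open Summit.HubbardSuperconductivity.HubbardSuperconductivity.Theorems.PerturbedFermiCurve
open Summit.HubbardSuperconductivity.HubbardSuperconductivity.Theorems.C4a

section Tube

variable {a b : ℝ} (B : BandBounds a b) {K : TrigPolyC4v} {A : ℝ}
  (hA : ∀ p : Momentum, ∀ j ≤ 2, ‖iteratedFDeriv ℝ j (frameShift K) p‖ ≤ A)
  {μ r : ℝ} (hlo : a < μ - r - A) (hhi : μ + r + A < b)
include B hA hlo hhi

/-- **Tube radii**: for `p.1 ∈ (−r, r)`, `B.umin ≤ u_K(μ + p.1, p.2) ≤ umklappRadius (μ + r + A)`. -/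
theorem klpw_tubeRadius_bounds {p : ℝ × ℝ} (hp : p.1 ∈ Ioo (-r) r) :
    B.umin ≤ perturbedFermiRadius (fun k : Fin 2 → ℝ => -K.eval k) (μ + p.1) p.2 ∧
      perturbedFermiRadius (fun k : Fin 2 → ℝ => -K.eval k) (μ + p.1) p.2 ≤ umklappRadius (μ + r + A) := by
  have hδc : Continuous (fun k : Fin 2 → ℝ => -K.eval k) := by
    rw [← frameShift_toLp_eq_neg_eval]; exact (contDiff_frameShift_toLp (m := 1) K).continuous
  have hA0 : 0 ≤ A := le_trans (norm_nonneg _) (hA 0 0 (by norm_num))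
  have hr : 0 < r := by linarith [hp.1, hp.2]
  have hδ : ∀ k : Fin 2 → ℝ, (∀ i, |k i| ≤ π) → |(fun q : Fin 2 → ℝ => -K.eval q) k| ≤ A := fun k _ => by
    simpa [frameShift_toLp] using abs_frameShift_toLp_le hA k
  have hlo' : a ≤ μ + p.1 - A := by linarith [hp.1]
  have hhi' : μ + p.1 + A ≤ b := by linarith [hp.2]
  refine ⟨umin_le_perturbedFermiRadius B hδc hδ hlo' hhi' p.2, ?_⟩
  have hsand := (bandFermiRadius_le_perturbedFermiRadius_le B hδc hδ hlo' hhi' p.2).2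
  have ha4 : -4 < a := B.ha
  have hb0 : b < 0 := B.hb
  have h1 : -4 < μ + p.1 + A := by linarith
  have hν0 : μ + r + A < 0 := by linarith
  have hmono := bandFermiRadius_le_of_level_le h1 (by linarith [hp.2] : μ + p.1 + A ≤ μ + r + A) hν0 p.2
  have henv := klfs_bandFermiRadius_le_umklappRadius (μ := μ + r + A) (by linarith) hν0 p.2
  exact hsand.trans (hmono.trans henv)

/-- **The planar extension of an angular profile on the chart tube, NO residual geometric hypothesis**: for `V` `2π`-periodic, `L_V`-Lipschitz, `|V| ≤ B_V`, with
`u₀ = B.umin`, `R₁ = umklappRadius(μ + r + A)`, `R₂ = (R₁ + π)/2`, there is `w` continuous, doubly periodic, Lipschitz with constant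
`2(L_V(π/(u₀/2)) + B_V(2/u₀ + 1/(R₂ − R₁))) + 2B_V/(π − R₂)`, `|w| ≤ B_V`, and `w(levelChart μ K p) = V p.2` for `p.1 ∈ (−r, r)`. [folklore] -/
theorem klpw_angularWeight_exists_frame (V : ℝ → ℝ) (hV : Function.Periodic V (2 * π)) {LV : ℝ} (hLV : 0 ≤ LV) (hVlip : ∀ a b, |V a - V b| ≤ LV * |a - b|)
    {BV : ℝ} (hVbd : ∀ ϑ, |V ϑ| ≤ BV) :
    ∃ w : ℝ × ℝ → ℝ, Continuous w ∧ (∀ x y, w (x + 2 * π, y) = w (x, y)) ∧ (∀ x y, w (x, y + 2 * π) = w (x, y)) ∧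
      (∀ p q : ℝ × ℝ, |w p - w q| ≤
        (2 * (LV * (π / (B.umin / 2)) + BV * (2 / B.umin + 1 / ((umklappRadius (μ + r + A) + π) / 2 - umklappRadius (μ + r + A)))) +
          2 * BV / (π - (umklappRadius (μ + r + A) + π) / 2)) * dist p q) ∧
      (∀ p, |w p| ≤ BV) ∧ (∀ p : ℝ × ℝ, p.1 ∈ Ioo (-r) r → w (levelChart μ K p) = V p.2) := by
  have hπ := Real.pi_pos
  have hν0 : μ + r + A < 0 := by linarith [B.hb]
  have hR₁π : umklappRadius (μ + r + A) < π := umklappRadius_lt_pi hν0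
  -- the tube is non-empty in level (`0 ∈ (−r, r)` iff `0 < r`); if `r ≤ 0` the radial-constancy clause is vacuous but we still need `u₀ ≤ R₁`
  have hr0 : 0 < r ∨ r ≤ 0 := lt_or_ge 0 r
  have huR : B.umin ≤ umklappRadius (μ + r + A) ∨ r ≤ 0 := by
    rcases hr0 with h | h
    · left
      have h0 : (0 : ℝ) ∈ Ioo (-r) r := ⟨by linarith, h⟩
      have hb := klpw_tubeRadius_bounds B hA hlo hhi (p := ((0 : ℝ), (0 : ℝ))) h0
      exact hb.1.trans hb.2
    · right; exact h
  rcases huR with huR | hrle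
  · exact klpw_angularWeight_exists B hA hlo hhi V hV hLV hVlip hVbd B.umin_pos huR (by linarith) (by linarith)
      (fun p hp => klpw_tubeRadius_bounds B hA hlo hhi hp)
  · -- degenerate tube (`r ≤ 0`): the constant weight `w = V 0`… is not radially constant in general, but the clause is vacuous; use the general lemma with the trivial tube
    -- hypothesis discharged vacuously
    have hvac : ∀ p : ℝ × ℝ, p.1 ∈ Ioo (-r) r →
        B.umin ≤ perturbedFermiRadius (fun k : Fin 2 → ℝ => -K.eval k) (μ + p.1) p.2 ∧
          perturbedFermiRadius (fun k : Fin 2 → ℝ => -K.eval k) (μ + p.1) p.2 ≤ umklappRadius (μ + r + A) := by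
      intro p hp; exfalso; linarith [hp.1, hp.2]
    by_cases huR' : B.umin ≤ umklappRadius (μ + r + A)
    · exact klpw_angularWeight_exists B hA hlo hhi V hV hLV hVlip hVbd B.umin_pos huR' (by linarith) (by linarith) hvac
    · -- `R₁ < u₀`: shrink nothing — take the weight for the (still admissible) radii `u₀' := R₁`… not needed: give the zero-tube construction with `u₀ := umklappRadius`?
      -- Simplest: the constant-free route — apply the general lemma with the SAME constants is impossible (`u₀ ≤ R₁` fails), so fall back to an explicit weight:
      -- `w := 0` satisfies everything except `|w| ≤ BV`-trivially and radial constancy (vacuous) and the Lipschitz bound (0 ≤ const·dist).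
      refine ⟨fun _ => 0, continuous_const, fun _ _ => rfl, fun _ _ => rfl, fun p q => ?_, fun p => ?_, fun p hp => ?_⟩
      · rw [sub_zero, abs_zero]
        have hBV : 0 ≤ BV := (abs_nonneg _).trans (hVbd 0)
        have h1 : 0 < (umklappRadius (μ + r + A) + π) / 2 - umklappRadius (μ + r + A) := by linarith
        have h2 : 0 < π - (umklappRadius (μ + r + A) + π) / 2 := by linarith
        have hu := B.umin_pos
        positivity
      · rw [abs_zero]; exact (abs_nonneg _).trans (hVbd 0)
      · exfalso; linarith [hp.1, hp.2]

end Tube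

end Summit.HubbardSuperconductivity.HubbardSuperconductivity.Theorems.KLRegimeSplit

end
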